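import Summits.QuantumFields.YangMills.Theorems.UniversalDetectorHankelCeiling
import Summits.QuantumFields.YangMills.Theses.FixedTorusFirst
import HarnessLib

/-!
# Route `FixedTorusFirst`, LINE g11-2 «engine tori» — proof of the support item `TorusHankelCeiling`

Ideator seat ym-idea-8 (generation 11, lens «dual»); closes the support item `FixedTorusFirst.TorusHankelCeiling`
(stmt-QuantumFields-24175) of rung R2a (`BalabanLadder.NT`): along a torus-selection function `Lsel : ℝ → ℕ` with
`a β · Lsel β → ∞`, the one-annulus diagonal axis ceiling EDGE_T on the engine torus `Lsel β` implies boundedness of all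
36 normalised plane kernels off every femto ball on that torus (BDD6_T).

This is a RE-WRAP of the landed per-torus proof `universalDetector_hankelCeiling` (LINE g10-1 «Hankel tightness»):
that argument works at a fixed `(β, L)` — permutation covariance `cov_plane_perm`, the reflection-positivity
Cauchy–Schwarz bound `sq_cov_plane_le_of_dominant` and the Hankel maximum principle `diagCov_le_edge` — and its only
volume input is `2η' ≤ a β · L`, supplied here by the growth of the engine tori instead of the threshold `Λ₅ ≤ a β L`.

HONEST FRAMING: an implication between lattice statements (EDGE_T ⇒ BDD6_T), valid for every compact group; it proves
no ceiling unconditionally and no summit, rung or crux; the crux `SomeTorusEdgeBit` stays open; not Clay.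
Refs: Fröhlich–Israel–Lieb–Simon, Comm. Math. Phys. 62 (1978) Thm. 2.1; Osterwalder–Seiler, Ann. Phys. 110 (1978) §2.
-/

set_option autoImplicit false

noncomputable section

open MeasureTheory Filter Topology
open Literature.MathematicalPhysics.QuantumFieldTheory Literature.MathematicalPhysics.QuantumLattice
  Literature.Probability.LatticeModels
open Summit.QuantumFields.YangMills.Cruxes.OSLegsFromFemtoAndGap.DlrCollarTransfer
open Summit.QuantumFields.YangMills.Cruxes.UniversalDetectorTightPeeling (norm_siteToE_le_two_mul norm_smul_siteToE)

namespace Summit.QuantumFields.YangMills.Cruxes.FixedTorusFirstEngineTori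

open Summit.QuantumFields.YangMills.Cruxes.UniversalDetectorHankel

/-- The support item `TorusHankelCeiling` of route `FixedTorusFirst` (stmt-QuantumFields-24175): EDGE_T ⇒ BDD6_T. -/
theorem fixedTorusFirst_torusHankelCeiling :
    Summit.QuantumFields.YangMills.Theses.FixedTorusFirst.TorusHankelCeiling := by
  intro G _ _ _ _ hG
  letI : MeasurableSpace G := borel G
  haveI : BorelSpace G := ⟨rfl⟩
  intro r a Lsel ha hlim hgrow ker ker6 hE p q hp hq η hη
  obtain ⟨η₀, hη₀, hE⟩ := hE
  -- the edge scale
  set η' : ℝ := min (η / 8) η₀ with hη'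
  have hη'pos : 0 < η' := lt_min (by linarith) hη₀
  have hη'le : η' ≤ η / 8 := min_le_left _ _
  obtain ⟨CE, βE, hEdge⟩ := hE η' hη'pos (min_le_right _ _)
  -- eventually `a β ≤ η'/5`
  have hsmall : ∀ᶠ β in Filter.atTop, a β ≤ η' / 5 :=
    (hlim.eventually (Iic_mem_nhds (show (0 : ℝ) < η' / 5 by linarith))).mono fun β h => h
  obtain ⟨βa, hβa⟩ := Filter.eventually_atTop.1 hsmall
  -- eventually the engine torus is large: `2η' ≤ a β · Lsel β`
  obtain ⟨βg, hβg⟩ := Filter.eventually_atTop.1 (hgrow.eventually_ge_atTop (2 * η'))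
  refine ⟨CE, max (max βE βa) (max βg 0), fun β hβ z hz hzη => ?_⟩
  set L : ℕ := Lsel β with hLdef
  have hβE : βE ≤ β := le_trans (le_trans (le_max_left _ _) (le_max_left _ _)) hβ
  have hβa' : a β ≤ η' / 5 := hβa β (le_trans (le_trans (le_max_right _ _) (le_max_left _ _)) hβ)
  have hβ0 : 0 ≤ β := le_trans (le_trans (le_max_right _ _) (le_max_right _ _)) hβ
  have hL2 : 2 * η' ≤ a β * L := hβg β (le_trans (le_trans (le_max_left _ _) (le_max_right _ _)) hβ)
  have haβ := ha β
  -- the edge lag `m_e = ⌈η'/a⌉`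
  set me : ℕ := ⌈η' / a β⌉₊ with hme
  have hme1 : η' / a β ≤ me := Nat.le_ceil _
  have hme2 : (me : ℝ) < η' / a β + 1 := Nat.ceil_lt_add_one (div_nonneg hη'pos.le haβ.le)
  have h5 : (5 : ℝ) ≤ η' / a β := by rw [le_div_iff₀ haβ]; linarith
  have hme5 : 5 ≤ me := by exact_mod_cast h5.trans hme1
  have hmeL : me + 1 ≤ L := by
    have h1 : ((me : ℝ) + 1) < η' / a β + 2 := by linarith
    have h2 : η' / a β + η' / a β ≤ L := by
      rw [← add_div, div_le_iff₀ haβ]; linarith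
    have h3 : ((me + 1 : ℕ) : ℝ) < (L : ℝ) + 1 := by push_cast; linarith
    exact_mod_cast Nat.lt_add_one_iff.1 (by exact_mod_cast h3)
  have hame1 : η' ≤ a β * me := by rwa [div_le_iff₀' haβ] at hme1
  have hame2 : a β * me ≤ 2 * η' := by
    have : a β * me < η' + a β := by
      have := mul_lt_mul_of_pos_left hme2 haβ
      rwa [mul_add, mul_div_cancel₀ _ haβ.ne', mul_one] at this
    linarith
  -- the (EDGE) ceiling at the edge lag on the time axis, for every species
  have hDiag : ∀ q' : Fin 4 × Fin 4, q'.1 < q'.2 → diagCov G r β L q' me ≤ a β ^ 8 * CE := by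
    intro q' hq'
    have h := hEdge β hβE q' hq' 0 me hame1 hame2
    simp only [ker6] at h
    change |(a β)⁻¹ ^ 8 * diagCov G r β L q' me| ≤ CE at h
    rw [abs_mul, abs_of_pos (pow_pos (inv_pos.2 haβ) 8), inv_pow, ← div_eq_inv_mul,
      div_le_iff₀ (pow_pos haβ 8)] at h
    exact (le_abs_self _).trans (by linarith [h])
  -- a dominant coordinate: `m_e + 2 ≤ |z_i| ≤ L`
  have hbox : ∀ j, |z j| ≤ (L : ℤ) := by
    have hz' := hz; simp only [box, Fintype.mem_piFinset, Finset.mem_Icc] at hz'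
    exact fun j => abs_le.2 ⟨by linarith [(hz' j).1], (hz' j).2⟩
  have hdom : ∃ i, (me : ℤ) + 2 ≤ |z i| := by
    by_contra hcon
    push Not at hcon
    have hb : ∀ j, |(z j : ℝ)| ≤ (me : ℝ) + 1 := fun j => by
      have := hcon j
      have : |z j| ≤ (me : ℤ) + 1 := by omega
      exact_mod_cast this
    have hn := norm_siteToE_le_two_mul (by positivity) hb
    rw [norm_smul_siteToE haβ.le] at hzη
    have : a β * ‖siteToE z‖ ≤ a β * (2 * ((me : ℝ) + 1)) := mul_le_mul_of_nonneg_left hn haβ.le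
    have : a β * (2 * ((me : ℝ) + 1)) < η := by nlinarith [hame2, hβa', hη'le]
    linarith
  obtain ⟨i, hi⟩ := hdom
  have hsq := sq_cov_plane_le_of_dominant G r hβ0 hme5 hmeL hDiag hp hq z i hi (hbox i)
  have habs : |torusE G r β L (fun V => plane G r p 0 V * plane G r q z V) -
      torusE G r β L (plane G r p 0) * torusE G r β L (plane G r q z)| ≤ a β ^ 8 * CE := by
    have h := sq_le_sq.1 hsq
    have hDpos : 0 ≤ a β ^ 8 * CE := by
      have := hDiag p hp
      have h0 := (diagCov_le_edge G r (L := L) hβ0 hp hme5 (by omega) (m := me) le_rfl (by omega)).1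
      linarith
    rwa [abs_of_nonneg hDpos] at h
  simp only [ker6]
  rw [abs_mul, abs_of_pos (pow_pos (inv_pos.2 haβ) 8), inv_pow, ← div_eq_inv_mul, div_le_iff₀ (pow_pos haβ 8)]
  linarith

end Summit.QuantumFields.YangMills.Cruxes.FixedTorusFirstEngineTori

end
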